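import Mathlib.RingTheory.Smooth.Field
import Mathlib.RingTheory.Smooth.Basic
import Mathlib.RingTheory.AlgebraicIndependent.TranscendenceBasis
import Mathlib.FieldTheory.KummerPolynomial
import Mathlib.RingTheory.LocalRing.MaximalIdeal.Basic
import Mathlib.RingTheory.Ideal.Quotient.Operations
import Mathlib.Algebra.CharP.Algebra
import Mathlib.Algebra.CharP.Quotient
import Mathlib.Algebra.Algebra.Rat
import Mathlib.Order.Zorn
import HarnessLib

/-!
# Coefficient fields of square-zero thickenings (Cohen; Matsumura Thm. 28.3 (ii), case `𝔪² = 0`)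

Topic: `Literature/RingTheory/CompleteLocalRings`. Let `A` be a commutative ring containing a
field `k` (an *equicharacteristic* ring) and `I ⊆ A` a maximal ideal with `I² = 0`, so that `A`
is a local ring with maximal ideal `I`, trivially complete. I. S. Cohen's structure theorem
(Matsumura, *Commutative Ring Theory*, Thm. 28.3 (ii): "if `A` is complete, it has a coefficient
field") says that the projection `A → A/I` admits a ring-theoretic section, i.e. `A` contains a
field mapping isomorphically onto its residue field. We PROVE this square-zero case, which is
the one needed for the Jacobian criteria of §30 (it yields enough derivations of a local ring
into its residue field, see `WeakJacobianPolynomial`):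

* `exists_ringHom_section_of_sq_eq_bot` — for `k` a field, `A` a `k`-algebra, `I` maximal with
  `I ^ 2 = ⊥`: `∃ σ : A ⧸ I →+* A, ∀ x, Ideal.Quotient.mk I (σ x) = x`.

The proof is Cohen's, split by the characteristic of `k`:

* characteristic `p > 0` (`exists_ringHom_section_of_sq_eq_bot_of_charP`): the Frobenius of `A`
  kills `I` (as `I² = 0` and `p ≥ 2`), so `Aᵖ = {aᵖ}` is a subfield of `A`; a subring `K'` of `A`
  which is a field, contains `Aᵖ`, and is maximal with these properties (Zorn) maps onto `A/I`:
  otherwise pick `t ∉ im K'`, a lift `y`, and observe that `K'[y] ≅ K'[T]/(Tᵖ - yᵖ)` is again a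
  field (`Tᵖ - yᵖ` is irreducible over `K'` since `yᵖ ∈ Aᵖ ⊆ K'` is not a `p`-th power in `K'`),
  contradicting maximality;
* characteristic `0` (`exists_ringHom_section_of_sq_eq_bot_of_algebraRat`): `A/I` is formally
  smooth over `ℚ` (a transcendence basis is separating in characteristic zero; Mathlib's
  `Algebra.FormallySmooth.of_algebraicIndependent_of_isSeparable`), so the identity of `A/I`
  lifts through the nilpotent thickening `A → A/I` (`Algebra.FormallySmooth.exists_lift`).

Also: `isUnit_of_not_mem_of_sq_eq_bot`, `isLocalRing_of_isMaximal_of_sq_eq_bot` (such an `A`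
is local with maximal ideal `I`).

## Sources

* H. Matsumura, *Commutative Ring Theory*, CUP 1986, §28, p. 215 [PDF 232]: definition of
  coefficient field and Thm. 28.3. [Matsumura1987]
* I. S. Cohen, *On the structure and ideal theory of complete local rings*, Trans. AMS 59 (1946),
  Thm. 9 (existence of coefficient fields in the equicharacteristic case).

What is NOT here: the general complete case (needs the limit over `A/𝔪ⁿ` and uniqueness
statements), quasi-coefficient fields, the unequal-characteristic case (coefficient rings).
-/

noncomputable section

open Polynomial

namespace Literature.RingTheory.CompleteLocalRings

universe u

section General

variable {A : Type u} [CommRing A] (I : Ideal A)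

/-- If `I² = 0` then products of elements of `I` vanish. [folklore] -/
theorem mul_eq_zero_of_mem_of_sq_eq_bot (hI2 : I ^ 2 = ⊥) {x y : A} (hx : x ∈ I) (hy : y ∈ I) :
    x * y = 0 := by
  rw [← Ideal.mem_bot, ← hI2, pow_two]
  exact Ideal.mul_mem_mul hx hy

/-- If `I` is maximal and `I² = 0`, every element outside `I` is a unit (`I + (x) = A` gives
`a + bx = 1` with `a ∈ I`, and `1 - a` is a unit as `a² = 0`). [folklore] -/
theorem isUnit_of_not_mem_of_sq_eq_bot [hI : I.IsMaximal] (hI2 : I ^ 2 = ⊥) {x : A}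
    (hx : x ∉ I) : IsUnit x := by
  obtain ⟨a, ha, b, hab⟩ : ∃ a ∈ I, ∃ b, a + b * x = 1 := by
    have h := hI.exists_inv hx
    obtain ⟨b, a, ha, h⟩ := h
    exact ⟨a, ha, b, by linear_combination h⟩
  have hu : IsUnit (b * x) := by
    have h1 : b * x = 1 - a := by linear_combination hab
    rw [h1]
    refine ⟨⟨1 - a, 1 + a, ?_, ?_⟩, rfl⟩
    · have := mul_eq_zero_of_mem_of_sq_eq_bot I hI2 ha ha
      linear_combination (-1 : A) * this
    · have := mul_eq_zero_of_mem_of_sq_eq_bot I hI2 ha ha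
      linear_combination (-1 : A) * this
  exact isUnit_of_mul_isUnit_right hu

/-- If `I` is maximal and `I² = 0` then `A` is a local ring. [folklore] -/
theorem isLocalRing_of_isMaximal_of_sq_eq_bot [hI : I.IsMaximal] (hI2 : I ^ 2 = ⊥) :
    IsLocalRing A := by
  haveI : Nontrivial A := ⟨⟨0, 1, fun h => hI.ne_top (I.eq_top_iff_one.mpr (h ▸ I.zero_mem))⟩⟩
  refine IsLocalRing.of_isUnit_or_isUnit_one_sub_self fun a => ?_
  by_cases ha : a ∈ I
  · refine Or.inr (isUnit_of_not_mem_of_sq_eq_bot I hI2 fun h => ?_)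
    exact hI.ne_top (I.eq_top_iff_one.mpr (by simpa using I.add_mem h ha))
  · exact Or.inl (isUnit_of_not_mem_of_sq_eq_bot I hI2 ha)

/-- If `I` is maximal and `I² = 0` then `I` is the maximal ideal of the local ring `A`.
[folklore] -/
theorem eq_maximalIdeal_of_sq_eq_bot [hI : I.IsMaximal] (hI2 : I ^ 2 = ⊥) :
    haveI := isLocalRing_of_isMaximal_of_sq_eq_bot I hI2
    I = IsLocalRing.maximalIdeal A :=
  haveI := isLocalRing_of_isMaximal_of_sq_eq_bot I hI2
  IsLocalRing.eq_maximalIdeal hI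

end General

/-! ## Characteristic `p`: Cohen's argument with the Frobenius -/

section CharP

variable {A : Type u} [CommRing A]

/-- In characteristic `p`, `xᵖ = 0` for `x ∈ I` when `I² = 0`. [folklore] -/
theorem pow_char_eq_zero_of_mem (I : Ideal A) (p : ℕ) [hp : Fact p.Prime] (hI2 : I ^ 2 = ⊥) {x : A}
    (hx : x ∈ I) : x ^ p = 0 := by
  obtain ⟨m, hm⟩ := Nat.exists_eq_add_of_le hp.out.two_le
  rw [hm, pow_add, pow_two, mul_eq_zero_of_mem_of_sq_eq_bot I hI2 hx hx, zero_mul]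

/-- A subring `F` of `A` in which nonzero elements are invertible meets a proper ideal `I`
trivially: the projection `A → A/I` is injective on it. [folklore] -/
theorem eq_zero_of_mem_of_forall_exists_inv (I : Ideal A) [hI : I.IsMaximal] {F : Subring A}
    (hFinv : ∀ x ∈ F, x ≠ 0 → ∃ y ∈ F, x * y = 1) {x : A} (hxF : x ∈ F) (hxI : x ∈ I) : x = 0 := by
  by_contra hx0
  obtain ⟨y, -, hxy⟩ := hFinv x hxF hx0
  exact hI.ne_top (I.eq_top_iff_one.mpr (hxy ▸ I.mul_mem_right y hxI))

/-- A subring (of a nontrivial ring) in which nonzero elements are invertible is a field.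
[folklore] -/
theorem isField_of_forall_exists_inv [Nontrivial A] {F : Subring A}
    (hFinv : ∀ x ∈ F, x ≠ 0 → ∃ y ∈ F, x * y = 1) : IsField F := by
  refine ⟨⟨0, 1, zero_ne_one⟩, mul_comm, fun {a} ha => ?_⟩
  obtain ⟨y, hy, hay⟩ := hFinv a a.2 fun h => ha (Subtype.ext h)
  exact ⟨⟨y, hy⟩, Subtype.ext hay⟩

/-- **Cohen's key step.** Let `I` be a maximal ideal of a ring `A` of characteristic `p`, and
`F ⊆ A` a subring which is a field and contains all `p`-th powers. If `t ∈ A/I` is not in the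
image of `F`, then `F` is strictly contained in a larger such subring: for a lift `y` of `t`,
the subring `F[y]` is a field — it is `F[T]/(Tᵖ - yᵖ)`, and `Tᵖ - yᵖ` is irreducible over (the
field of fractions `L ≅ F` of) `F` because `yᵖ ∈ F` is not a `p`-th power in `F`.
[cite: Matsumura1987, Thm. 28.3 (ii) (case 𝔪² = 0)] -/
theorem exists_gt_of_not_mem_range (I : Ideal A) [hI : I.IsMaximal] (p : ℕ) [hp : Fact p.Prime]
    [CharP A p] {F : Subring A} (hFp : ∀ x : A, x ^ p ∈ F)
    (hFinv : ∀ x ∈ F, x ≠ 0 → ∃ y ∈ F, x * y = 1)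
    {t : A ⧸ I} (ht : ∀ x ∈ F, Ideal.Quotient.mk I x ≠ t) :
    ∃ F' : Subring A, (∀ x : A, x ^ p ∈ F') ∧ (∀ x ∈ F', x ≠ 0 → ∃ y ∈ F', x * y = 1) ∧
      F ≤ F' ∧ F ≠ F' := by
  classical
  haveI : Nontrivial A := ⟨⟨0, 1, fun h => hI.ne_top (I.eq_top_iff_one.mpr (h ▸ I.zero_mem))⟩⟩
  have hFf : IsField F := isField_of_forall_exists_inv hFinv
  haveI : IsDomain F := hFf.isDomain
  -- an honest field `L ≅ F` (the fraction field of the field `F`)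
  set L := FractionRing F with hL
  have hj : Function.Bijective (algebraMap F L) :=
    IsField.localization_map_bijective (M := nonZeroDivisors F) zero_notMem_nonZeroDivisors hFf
  set j : F ≃+* L := RingEquiv.ofBijective (algebraMap F L) hj with hjdef
  -- the embedding `i : L → A` and the evaluation maps `φ : L[T] → A`, `ψ : L[T] → A/I` at `y`, `t`
  set i : L →+* A := F.subtype.comp j.symm.toRingHom with hi
  have hiF : ∀ a : F, i (j a) = a := fun a => by
    simp [hi]
  have hirange : ∀ z : L, i z ∈ F := fun z => by
    simp [hi]
  obtain ⟨y, rfl⟩ := Ideal.Quotient.mk_surjective t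
  set φ : L[X] →+* A := Polynomial.eval₂RingHom i y with hφ
  set ψ : L[X] →+* A ⧸ I := (Ideal.Quotient.mk I).comp φ with hψ
  have hφC : ∀ z : L, φ (C z) = i z := fun z => by simp [hφ]
  have hφX : φ X = y := by simp [hφ]
  -- `c = yᵖ ∈ F` and the polynomial `g = Tᵖ - c`
  set c : F := ⟨y ^ p, hFp y⟩ with hc
  set g : L[X] := X ^ p - C (j c) with hg
  have hφg : φ g = 0 := by
    simp only [hg, map_sub, map_pow, hφX, hφC, hiF, hc, sub_self]
  -- `g` is irreducible: `c` is not a `p`-th power in `L ≅ F`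
  have hirr : Irreducible g := by
    refine X_pow_sub_C_irreducible_of_prime hp.out fun b hb => ?_
    have hb' : (i b) ^ p = y ^ p := by
      have := congrArg i hb
      rwa [map_pow, hiF] at this
    apply ht (i b) (hirange b)
    have h0 : (Ideal.Quotient.mk I (i b - y)) ^ p = 0 := by
      rw [← map_pow, sub_pow_char, hb', sub_self, map_zero]
    have h1 : Ideal.Quotient.mk I (i b - y) = 0 := (pow_eq_zero_iff hp.out.ne_zero).mp h0
    rwa [map_sub, sub_eq_zero] at h1
  have hmax : (Ideal.span {g}).IsMaximal := PrincipalIdealRing.isMaximal_of_irreducible hirr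
  -- kernels: `ker φ = ker ψ = (g)`
  have hkerψ : RingHom.ker ψ = Ideal.span {g} := by
    refine (hmax.eq_of_le (RingHom.ker_ne_top ψ) ?_).symm
    rw [Ideal.span_le, Set.singleton_subset_iff, SetLike.mem_coe, RingHom.mem_ker, hψ,
      RingHom.comp_apply, hφg, map_zero]
  have hkerφ : RingHom.ker φ = Ideal.span {g} := by
    refine le_antisymm ?_ ?_
    · rw [← hkerψ]
      intro x hx
      rw [RingHom.mem_ker] at hx ⊢
      rw [hψ, RingHom.comp_apply, hx, map_zero]
    · rw [Ideal.span_le, Set.singleton_subset_iff, SetLike.mem_coe, RingHom.mem_ker, hφg]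
  -- hence `F' = im φ` is a field
  have hF'field : IsField φ.range := by
    haveI : (RingHom.ker φ).IsMaximal := hkerφ ▸ hmax
    exact MulEquiv.isField ((Ideal.Quotient.maximal_ideal_iff_isField_quotient _).mp ‹_›)
      (RingHom.quotientKerEquivRange φ).symm.toMulEquiv
  have hFle : F ≤ φ.range := fun a ha => ⟨C (j ⟨a, ha⟩), by rw [hφC, hiF]⟩
  refine ⟨φ.range, fun x => hFle (hFp x), fun x hx hx0 => ?_, hFle, fun heq => ?_⟩
  · obtain ⟨z, hz⟩ := hF'field.mul_inv_cancel (a := ⟨x, hx⟩) fun h => hx0 (congrArg Subtype.val h)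
    exact ⟨z, z.2, congrArg Subtype.val hz⟩
  · have hy : y ∈ F := by rw [heq]; exact ⟨X, hφX⟩
    exact ht y hy rfl

/-- **Coefficient fields in characteristic `p` (Cohen).** If `A` has prime characteristic `p` and
`I` is a maximal ideal with `I² = 0`, then `A → A/I` has a ring section. Proof: the Frobenius
kills `I`, so `Aᵖ` is a subring which is a field and contains all `p`-th powers; Zorn gives a
maximal such subring `K'`, which maps isomorphically onto `A/I` by the key step
`exists_gt_of_not_mem_range`. [cite: Matsumura1987, Thm. 28.3 (ii) (case 𝔪² = 0)] -/
theorem exists_ringHom_section_of_sq_eq_bot_of_charP (I : Ideal A) [hI : I.IsMaximal] (p : ℕ)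
    [hp : Fact p.Prime] [CharP A p] (hI2 : I ^ 2 = ⊥) :
    ∃ σ : A ⧸ I →+* A, ∀ x, Ideal.Quotient.mk I (σ x) = x := by
  haveI := ExpChar.prime (R := A) hp.out
  -- Cohen's family of subrings: fields containing all `p`-th powers
  set 𝒮 : Set (Subring A) :=
    {F | (∀ x : A, x ^ p ∈ F) ∧ ∀ x ∈ F, x ≠ 0 → ∃ y ∈ F, x * y = 1} with h𝒮
  -- `Aᵖ ∈ 𝒮`
  have h0 : (frobenius A p).range ∈ 𝒮 := by
    refine ⟨fun x => ⟨x, rfl⟩, ?_⟩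
    rintro _ ⟨a, rfl⟩ ha
    have ha' : a ∉ I := fun h => ha (by
      rw [frobenius_def]; exact pow_char_eq_zero_of_mem I p hI2 h)
    obtain ⟨u, hu⟩ := isUnit_of_not_mem_of_sq_eq_bot I hI2 ha'
    refine ⟨frobenius A p ↑u⁻¹, ⟨_, rfl⟩, ?_⟩
    rw [← map_mul, ← hu, Units.mul_inv, map_one]
  -- chains in `𝒮` are bounded by their union
  have hchain : ∀ c ⊆ 𝒮, IsChain (· ≤ ·) c → ∀ F₀ ∈ c, ∃ ub ∈ 𝒮, ∀ F ∈ c, F ≤ ub := by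
    intro c hc hch F₀ hF₀
    have hne : c.Nonempty := ⟨F₀, hF₀⟩
    have hdir : DirectedOn (· ≤ ·) c := hch.directedOn
    refine ⟨sSup c, ⟨fun x => ?_, fun x hx hx0 => ?_⟩, fun F hF => le_sSup hF⟩
    · exact (Subring.mem_sSup_of_directedOn hne hdir).mpr ⟨F₀, hF₀, (hc hF₀).1 x⟩
    · obtain ⟨F, hF, hxF⟩ := (Subring.mem_sSup_of_directedOn hne hdir).mp hx
      obtain ⟨y, hy, hxy⟩ := (hc hF).2 x hxF hx0
      exact ⟨y, (Subring.mem_sSup_of_directedOn hne hdir).mpr ⟨F, hF, hy⟩, hxy⟩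
  -- a maximal member `K'` of Cohen's family
  obtain ⟨K', -, hK'⟩ := zorn_le_nonempty₀ 𝒮 hchain (frobenius A p).range h0
  have hK'mem : K' ∈ 𝒮 := hK'.prop
  -- the projection restricted to `K'` is bijective onto `A/I`
  set π : K' →+* A ⧸ I := (Ideal.Quotient.mk I).comp K'.subtype with hπ
  have hinj : Function.Injective π := by
    rw [injective_iff_map_eq_zero]
    intro x hx
    have hxI : (x : A) ∈ I := Ideal.Quotient.eq_zero_iff_mem.mp hx
    exact Subtype.ext (eq_zero_of_mem_of_forall_exists_inv I hK'mem.2 x.2 hxI)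
  have hsurj : Function.Surjective π := by
    intro t
    by_contra hne
    push Not at hne
    obtain ⟨F', hF'p, hF'inv, hle, hne'⟩ := exists_gt_of_not_mem_range I p hK'mem.1 hK'mem.2
      (t := t) fun x hx h => hne ⟨x, hx⟩ h
    exact hne' (le_antisymm hle (hK'.le_of_ge ⟨hF'p, hF'inv⟩ hle))
  let e : K' ≃+* A ⧸ I := RingEquiv.ofBijective π ⟨hinj, hsurj⟩
  refine ⟨K'.subtype.comp e.symm.toRingHom, fun x => ?_⟩
  change π (e.symm x) = x
  exact e.apply_symm_apply x

end CharP

/-! ## Characteristic `0`: formal smoothness of fields over `ℚ` -/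

section CharZero

/-- Every field of characteristic zero is formally smooth over `ℚ`: a transcendence basis over
`ℚ` is separating, the algebraic part being separable in characteristic zero (Matsumura
Thm. 26.9 for `k = ℚ`; assembled from Mathlib's
`Algebra.FormallySmooth.of_algebraicIndependent_of_isSeparable`).
[cite: Matsumura1987, Thm. 26.9] -/
theorem formallySmooth_rat (K : Type u) [Field K] [Algebra ℚ K] : Algebra.FormallySmooth ℚ K := by
  haveI : CharZero K := by
    haveI : CharZero ℚ := inferInstance
    exact charZero_of_injective_algebraMap (algebraMap ℚ K).injective
  obtain ⟨s, hs⟩ := exists_isTranscendenceBasis ℚ K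
  haveI := hs.isAlgebraic_field
  haveI : Algebra.IsSeparable (IntermediateField.adjoin ℚ (Set.range ((↑) : s → K))) K :=
    Algebra.IsAlgebraic.isSeparable_of_perfectField
  exact Algebra.FormallySmooth.of_algebraicIndependent_of_isSeparable hs.1

variable {A : Type u} [CommRing A] [Algebra ℚ A] (I : Ideal A) [hI : I.IsMaximal]

/-- **Coefficient fields in characteristic `0`.** If `A` is a `ℚ`-algebra and `I` is a maximal
ideal with `I² = 0`, then `A → A/I` has a ring section: the identity of the field `A/I`, which
is formally smooth over `ℚ`, lifts through the nilpotent thickening `A → A/I`.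
[cite: Matsumura1987, Thm. 28.3 (ii) (case 𝔪² = 0)] -/
theorem exists_ringHom_section_of_sq_eq_bot_of_algebraRat (hI2 : I ^ 2 = ⊥) :
    ∃ σ : A ⧸ I →+* A, ∀ x, Ideal.Quotient.mk I (σ x) = x := by
  letI : Field (A ⧸ I) := Ideal.Quotient.field I
  haveI : Algebra.FormallySmooth ℚ (A ⧸ I) := formallySmooth_rat (A ⧸ I)
  have hnil : IsNilpotent I := ⟨2, hI2⟩
  obtain ⟨f, hf⟩ := Algebra.FormallySmooth.exists_lift (R := ℚ) (A := A ⧸ I) I hnil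
    (AlgHom.id ℚ (A ⧸ I))
  refine ⟨f.toRingHom, fun x => ?_⟩
  have := congrArg (fun φ : (A ⧸ I) →ₐ[ℚ] A ⧸ I => φ x) hf
  simpa using this

end CharZero

/-! ## Equicharacteristic assembly -/

/-- **Cohen's theorem on coefficient fields, square-zero case** (Matsumura Thm. 28.3 (ii):
a complete equicharacteristic local ring has a coefficient field; here `𝔪² = 0`, so
completeness is automatic). If `A` is an algebra over a field `k` and `I ⊆ A` is a maximal ideal
with `I² = 0`, then the projection `A → A/I` admits a ring homomorphism section
`σ : A/I → A`; its image is a coefficient field of the local ring `(A, I)`.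
[cite: Matsumura1987, Thm. 28.3 (ii) (case 𝔪² = 0)] -/
theorem exists_ringHom_section_of_sq_eq_bot (k : Type*) {A : Type u} [Field k] [CommRing A]
    [Algebra k A] (I : Ideal A) [hI : I.IsMaximal] (hI2 : I ^ 2 = ⊥) :
    ∃ σ : A ⧸ I →+* A, ∀ x, Ideal.Quotient.mk I (σ x) = x := by
  haveI : Nontrivial A := ⟨⟨0, 1, fun h => hI.ne_top (I.eq_top_iff_one.mpr (h ▸ I.zero_mem))⟩⟩
  obtain ⟨p, hp⟩ := CharP.exists k
  haveI := hp
  rcases CharP.char_is_prime_or_zero k p with hprime | rfl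
  · haveI : Fact p.Prime := ⟨hprime⟩
    haveI : CharP A p := charP_of_injective_algebraMap (algebraMap k A).injective p
    exact exists_ringHom_section_of_sq_eq_bot_of_charP I p hI2
  · haveI : CharZero k := CharP.charP_to_charZero k
    letI : Algebra ℚ A := ((algebraMap k A).comp (algebraMap ℚ k)).toAlgebra
    exact exists_ringHom_section_of_sq_eq_bot_of_algebraRat I hI2

end Literature.RingTheory.CompleteLocalRings

end
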